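import Summits.QuantumAdvantage.QuantumAdvantage.Theorems.CharDialStrataDialA
import HarnessLib

/-!
# CharDialStrataDialB — tree twin (part B) of the decomp-qadv lens-5 g31 node «StrataDial» on `CharDial.FrobStructureLawOdd`

§3 the Möbius strata of a slice (`moeb_restr_sum`, `moeb_slice`) and the exchangeability criterion (`swapInv_of_moeb_insert`);
§4 THE DIAL `Flat p f X ℓ` (flatness depth of the mod-`p` Möbius table `chi`), the flat seed `FlatSeedFrom`, the ladder
`flatSeed_base` / `flatSeed_step` / `flatSeed_all`, and `seedAt_of_tabAt : TableDial.TabAt p → TableDial.SeedAt p`.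
See part A (`CharDialStrataDialA`) for the node docstring, the density lemma and `glueAt_holds`.  No `sorry`, no instances, no notation.
-/

set_option autoImplicit false
set_option linter.dupNamespace false

namespace Summit.QuantumAdvantage.QuantumAdvantage.Theorems.StrataDial

open Finset
open Summit.QuantumAdvantage.AdviceFreeQNC0
open Literature.Computability.MetaComplexity Literature.Computability.MetaComplexity.Smolensky
open Summit.QuantumAdvantage.QuantumAdvantage.Theorems.IslandDial (Exch TopConst ExchCoreAt ExchCoreOdd IslandAt IslandOdd
  NormalForm lawAt_of_pieces)
open Summit.QuantumAdvantage.QuantumAdvantage.Theorems.LevelDial (RPrimeAt nB BaseAt BaseOdd TailAt GlueAt GlueOdd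
  depOn_slice hasDegF_slice topConst_slice exch_mono)
open Summit.QuantumAdvantage.QuantumAdvantage.Theorems.TableDial (TabLaw TabAt TabOdd SeedLevel SeedAt SeedOdd FewAt FewOdd
  tabLaw_all_of_core tabAt_iff_all exchCoreAt_of_seed_tab_glue tabAt_of_exchCoreAt fewAt_of_exchCoreAt)

/-! ### §3 Möbius strata of slices, and the exchangeability criterion -/

section Slice

variable {F : Type*} [Field F] {n : ℕ}

/-- Möbius coefficients of a restriction (the computation inside the tree's `SubLog.moeb_restr_eq_of_card_eq`, exported):
`μ_T(g|_{S, outside frozen to v}) = Σ_A μ_A(g) · [A ∩ S = T ∧ A ∖ S ⊆ ones(v)]`. -/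
theorem moeb_restr_sum (g : CubeFn F n) (S : Finset (Fin n)) (v : Fin n → Bool) (T : Finset (Fin n)) :
    SubLog.moeb (SubLog.restr S v g) T =
      ∑ A : Finset (Fin n), SubLog.moeb g A * (if A ∩ S = T ∧ (∀ i ∈ A \ S, v i = true) then 1 else 0) := by
  classical
  let L : CubeFn F n →ₗ[F] F :=
    { toFun := fun h => SubLog.moeb (SubLog.restr S v h) T
      map_add' := fun h h' => by
        show SubLog.moeb (SubLog.restr S v (h + h')) T = SubLog.moeb (SubLog.restr S v h) T + SubLog.moeb (SubLog.restr S v h') T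
        have hh : SubLog.restr S v (h + h') = SubLog.restr S v h + SubLog.restr S v h' := rfl
        rw [hh, SubLog.moeb_add]
      map_smul' := fun a h => by
        show SubLog.moeb (SubLog.restr S v (a • h)) T = a • SubLog.moeb (SubLog.restr S v h) T
        have hh : SubLog.restr S v (a • h) = a • SubLog.restr S v h := rfl
        rw [hh, SubLog.moeb_smul, smul_eq_mul] }
  have hL : ∀ h, L h = SubLog.moeb (SubLog.restr S v h) T := fun h => rfl
  rw [← hL]
  conv_lhs => rw [SubLog.eq_sum_moeb_smul_mono g]
  rw [map_sum]
  refine Finset.sum_congr rfl fun A _ => ?_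
  rw [map_smul, smul_eq_mul, hL, SubLog.moeb_restr_mono']

/-- **SLICE FORMULA.**  For `T ⊆ B`: `μ_T(g|_{B, outside frozen to x}) = Σ_{U ⊆ ones(x) ∖ B} μ_{T ∪ U}(g)`. -/
theorem moeb_slice (g : CubeFn F n) (B : Finset (Fin n)) (x : Fin n → Bool) {T : Finset (Fin n)} (hT : T ⊆ B) :
    SubLog.moeb (SubLog.restr B x g) T =
      ∑ U ∈ ((Finset.univ \ B).filter fun k => x k = true).powerset, SubLog.moeb g (T ∪ U) := by
  classical
  rw [moeb_restr_sum]
  simp_rw [mul_boole]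
  rw [← Finset.sum_filter]
  set W : Finset (Fin n) := (Finset.univ \ B).filter fun k => x k = true with hW
  have hkey : ∀ U ∈ W.powerset, (T ∪ U) \ B = U := by
    intro U hU
    have hUW := Finset.mem_powerset.1 hU
    ext k
    rw [Finset.mem_sdiff, Finset.mem_union]
    constructor
    · rintro ⟨hk | hk, hkB⟩
      · exact absurd (hT hk) hkB
      · exact hk
    · intro hk
      exact ⟨Or.inr hk, (Finset.mem_sdiff.1 (Finset.mem_filter.1 (hUW hk)).1).2⟩
  have himg : (Finset.univ.filter fun A : Finset (Fin n) => A ∩ B = T ∧ ∀ i ∈ A \ B, x i = true) =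
      W.powerset.image fun U => T ∪ U := by
    ext A
    simp only [Finset.mem_filter, Finset.mem_univ, true_and, Finset.mem_image, Finset.mem_powerset]
    constructor
    · rintro ⟨hAB, hAx⟩
      refine ⟨A \ B, fun k hk => Finset.mem_filter.2 ⟨Finset.mem_sdiff.2 ⟨Finset.mem_univ _, (Finset.mem_sdiff.1 hk).2⟩,
        hAx k hk⟩, ?_⟩
      rw [← hAB]
      ext k
      rw [Finset.mem_union, Finset.mem_inter, Finset.mem_sdiff]
      tauto
    · rintro ⟨U, hUW, rfl⟩
      have hUB : ∀ k ∈ U, k ∉ B := fun k hk => (Finset.mem_sdiff.1 (Finset.mem_filter.1 (hUW hk)).1).2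
      refine ⟨?_, fun k hk => ?_⟩
      · ext k
        rw [Finset.mem_inter, Finset.mem_union]
        constructor
        · rintro ⟨hk | hk, hkB⟩
          · exact hk
          · exact absurd hkB (hUB k hk)
        · intro hk
          exact ⟨Or.inl hk, hT hk⟩
      · rw [hkey U (Finset.mem_powerset.2 hUW)] at hk
        exact (Finset.mem_filter.1 (hUW hk)).2
  rw [himg, Finset.sum_image]
  intro U hU U' hU' hUU'
  have h1 := hkey U hU
  have h2 := hkey U' hU'
  rw [← h1, ← h2]
  exact congrArg (· \ B) hUU'

end Slice

section Criterion

variable {R : Type*} [CommRing R] {n : ℕ}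

/-- **EXCHANGEABILITY CRITERION** (Möbius form): if `μ_{S ∪ i}(g) = μ_{S ∪ j}(g)` for every `S ∌ i, j`, then `g` is invariant under
the transposition `(i j)` (Möbius inversion `SubLog.sum_moeb_powerset` at the two points `u`, `u ∘ (i j)`). -/
theorem swapInv_of_moeb_insert (g : (Fin n → Bool) → R) {i j : Fin n} (hij : i ≠ j)
    (h : ∀ S : Finset (Fin n), i ∉ S → j ∉ S → SubLog.moeb g (insert i S) = SubLog.moeb g (insert j S)) :
    ∀ u : Fin n → Bool, g (u ∘ Equiv.swap i j) = g u := by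
  classical
  have main : ∀ u : Fin n → Bool, u i = false → u j = true → g (u ∘ Equiv.swap i j) = g u := by
    intro u hui huj
    set Y₀ : Finset (Fin n) := Finset.univ.filter fun k => u k = true ∧ k ≠ j with hY₀
    have hiY : i ∉ Y₀ := by simp [hY₀, hui]
    have hjY : j ∉ Y₀ := by simp [hY₀]
    have hu : u = SubLog.vert (insert j Y₀) := by
      funext k
      simp only [SubLog.vert, Finset.mem_insert, hY₀, Finset.mem_filter, Finset.mem_univ, true_and]
      by_cases hkj : k = j
      · subst hkj; simp [huj]
      · simp [hkj]
    have hus : u ∘ Equiv.swap i j = SubLog.vert (insert i Y₀) := by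
      funext k
      show u (Equiv.swap i j k) = _
      simp only [SubLog.vert, Finset.mem_insert, hY₀, Finset.mem_filter, Finset.mem_univ, true_and]
      by_cases hki : k = i
      · subst hki; rw [Equiv.swap_apply_left]; simp [huj]
      · by_cases hkj : k = j
        · subst hkj; rw [Equiv.swap_apply_right]; simp [hui, hki]
        · rw [Equiv.swap_apply_of_ne_of_ne hki hkj]
          simp [hki, hkj]
    rw [hus, hu, ← SubLog.sum_moeb_powerset g (insert i Y₀), ← SubLog.sum_moeb_powerset g (insert j Y₀),
      Finset.sum_powerset_insert hiY, Finset.sum_powerset_insert hjY]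
    congr 1
    refine Finset.sum_congr rfl fun S hS => ?_
    have hSY : S ⊆ Y₀ := Finset.mem_powerset.1 hS
    exact h S (fun hi => hiY (hSY hi)) (fun hj => hjY (hSY hj))
  intro u
  by_cases huij : u i = u j
  · rw [comp_swap_eq_self huij]
  cases hui : u i
  · have huj : u j = true := by
      cases huj : u j
      · exact absurd (hui.trans huj.symm) huij
      · rfl
    exact main u hui huj
  · have huj : u j = false := by
      cases huj : u j
      · rfl
      · exact absurd (hui.trans huj.symm) huij
    have h' := main (u ∘ Equiv.swap i j)
      (by show u (Equiv.swap i j i) = false; rw [Equiv.swap_apply_left, huj])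
      (by show u (Equiv.swap i j j) = true; rw [Equiv.swap_apply_right, hui])
    have hss : (u ∘ Equiv.swap i j) ∘ Equiv.swap i j = u := by
      funext k
      show u (Equiv.swap i j (Equiv.swap i j k)) = u k
      rw [Equiv.swap_apply_self]
    rw [hss] at h'
    exact h'.symm

end Criterion

/-! ### §4 The dial: flatness depth of the Möbius strata -/

section Strata

variable {p : ℕ} [hp : Fact p.Prime] {n : ℕ}

/-- The mod-`p` Möbius table of a Boolean function: `χ_f(T) = μ_T(1_f) ∈ 𝔽_p`. -/
def chi (p : ℕ) {n : ℕ} (f : (Fin n → Bool) → Bool) (T : Finset (Fin n)) : ZMod p := SubLog.moeb (SubLog.indR (ZMod p) f) T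

/-- **THE DIAL.**  `Flat p f X ℓ` — `f` is `ℓ`-FLAT on `X`: each of the top `ℓ` Möbius strata `k = p − ℓ, …, p − 1` of `χ_f` is
CONSTANT on the `k`-subsets of `X` (`ℓ = 1` is the class hypothesis `TopConst`; `ℓ = p − 1` means all strata below `p` are constant,
i.e. `f|_X` is symmetric).  Typed with `+` only: stratum `k` is in range iff `p ≤ k + ℓ` and `k + 1 ≤ p`. -/
def Flat (p : ℕ) {n : ℕ} (f : (Fin n → Bool) → Bool) (X : Finset (Fin n)) (ℓ : ℕ) : Prop :=
  ∀ k : ℕ, p ≤ k + ℓ → k + 1 ≤ p → ∀ T ⊆ X, ∀ T' ⊆ X, T.card = k → T'.card = k → chi p f T = chi p f T'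

/-- **FLAT SEED** at depth `ℓ` from level `m₀`: every `ℓ`-flat class member (depends on `X`, `|X| ≥ m₀`, `𝔽_p`-degree `≤ p − 1`,
constant non-zero top stratum on `X`) has `p − 1` pairwise exchangeable coordinates inside `X`.  Depth `1` is the g30 seed
`TableDial.SeedLevel` at every level `≥ m₀` (`seedLevel_of_flatSeedFrom_one`). -/
def FlatSeedFrom (p : ℕ) [Fact p.Prime] (ℓ m₀ : ℕ) : Prop :=
  ∀ (n : ℕ) (f : (Fin n → Bool) → Bool) (X : Finset (Fin n)), m₀ ≤ X.card → DependsOn f (↑X : Set (Fin n)) →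
    HasDegF p f (p - 1) → (∃ γ : ZMod p, γ ≠ 0 ∧ TopConst p f X γ) → Flat p f X ℓ →
    ∃ R : Finset (Fin n), R ⊆ X ∧ p - 1 ≤ R.card ∧ Exch f R

omit hp in
/-- A coordinate off `X` is irrelevant for the indicator of a function of `X`. -/
theorem indR_update_of_notMem {f : (Fin n → Bool) → Bool} {X : Finset (Fin n)} (hdep : DependsOn f (↑X : Set (Fin n)))
    {m : Fin n} (hm : m ∉ X) (u : Fin n → Bool) (b : Bool) :
    SubLog.indR (ZMod p) f (Function.update u m b) = SubLog.indR (ZMod p) f u := by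
  have hfu : f (Function.update u m b) = f u :=
    hdep fun k hk => Function.update_of_ne (fun hkm : k = m => hm (by rw [← hkm]; exact Finset.mem_coe.1 hk)) b u
  simp only [SubLog.indR, hfu]

/-- `χ_f` vanishes at sets not inside `X` (for `f` a function of `X`) … -/
theorem chi_eq_zero_of_not_subset {f : (Fin n → Bool) → Bool} {X : Finset (Fin n)} (hdep : DependsOn f (↑X : Set (Fin n)))
    {A : Finset (Fin n)} (hA : ¬ A ⊆ X) : chi p f A = 0 := by
  obtain ⟨m, hmA, hmX⟩ := Finset.not_subset.1 hA
  exact SubLog.moeb_eq_zero_of_indep (indR_update_of_notMem hdep hmX) hmA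

/-- … and above the degree. -/
theorem chi_eq_zero_of_card {f : (Fin n → Bool) → Bool} (hf : HasDegF p f (p - 1)) {A : Finset (Fin n)} (hA : p ≤ A.card) :
    chi p f A = 0 :=
  SubLog.moeb_eq_zero_of_mem_lowDeg ((SubLog.hasDegF_iff_indR p f (p - 1)).1 hf) (by have := hp.out.one_lt; omega)

/-- **EXCHANGEABILITY CRITERION** for class members: `χ_f(S ∪ i) = χ_f(S ∪ j)` for the `S ⊆ X ∖ {i, j}` with `|S| ≤ p − 2` already
forces invariance under `(i j)` (the other `S` give `0 = 0` by degree or by `DependsOn`). -/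
theorem swapInv_of_chi {f : (Fin n → Bool) → Bool} {X : Finset (Fin n)} (hdep : DependsOn f (↑X : Set (Fin n)))
    (hf : HasDegF p f (p - 1)) {i j : Fin n} (hij : i ≠ j)
    (h : ∀ S ⊆ X, i ∉ S → j ∉ S → S.card + 2 ≤ p → chi p f (insert i S) = chi p f (insert j S)) : SwapInv f i j := by
  classical
  have hG : ∀ u : Fin n → Bool, SubLog.indR (ZMod p) f (u ∘ Equiv.swap i j) = SubLog.indR (ZMod p) f u := by
    refine swapInv_of_moeb_insert (SubLog.indR (ZMod p) f) hij fun S hiS hjS => ?_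
    by_cases hSX : S ⊆ X
    · by_cases hc : S.card + 2 ≤ p
      · exact h S hSX hiS hjS hc
      · have h1 : chi p f (insert i S) = 0 := chi_eq_zero_of_card hf (by rw [Finset.card_insert_of_notMem hiS]; omega)
        have h2 : chi p f (insert j S) = 0 := chi_eq_zero_of_card hf (by rw [Finset.card_insert_of_notMem hjS]; omega)
        unfold chi at h1 h2
        rw [h1, h2]
    · have h1 : chi p f (insert i S) = 0 :=
        chi_eq_zero_of_not_subset hdep fun hins => hSX ((Finset.subset_insert i S).trans hins)
      have h2 : chi p f (insert j S) = 0 :=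
        chi_eq_zero_of_not_subset hdep fun hins => hSX ((Finset.subset_insert j S).trans hins)
      unfold chi at h1 h2
      rw [h1, h2]
  intro u
  have h1 := hG u
  simp only [SubLog.indR] at h1
  cases hu : f u <;> cases hus : f (u ∘ Equiv.swap i j) <;> simp_all

/-- The Möbius strata of a slice over `B`: `χ_{f|B,x}(T) = Σ_{U ⊆ ones(x) ∖ B} χ_f(T ∪ U)` (`T ⊆ B`). -/
theorem chi_slice (f : (Fin n → Bool) → Bool) (B : Finset (Fin n)) (x : Fin n → Bool) {T : Finset (Fin n)} (hT : T ⊆ B) :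
    chi p (fun u => f (SubLog.merge B u x)) T =
      ∑ U ∈ ((Finset.univ \ B).filter fun k => x k = true).powerset, chi p f (T ∪ U) :=
  moeb_slice (SubLog.indR (ZMod p) f) B x hT

/-- **BASE OF THE LADDER** (depth `p − 1`): all strata `1 … p − 1` constant on `X` ⟹ `f` is exchangeable on all of `X`. -/
theorem flatSeed_base : FlatSeedFrom p (p - 1) (p - 1) := by
  intro n f X hXc hdep hf _ hflat
  refine ⟨X, subset_refl X, hXc, fun i hi j hj => ?_⟩
  by_cases hij : i = j
  · subst hij
    exact SubChar.swapInv_self f i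
  refine swapInv_of_chi hdep hf hij fun S hSX hiS hjS hSc => hflat (S.card + 1) (by omega) (by omega) _
    (Finset.insert_subset hi hSX) _ (Finset.insert_subset hj hSX) (Finset.card_insert_of_notMem hiS)
    (Finset.card_insert_of_notMem hjS)

/-- **THE LADDER STEP** (one-stratum Ramsey + the table law + slices vote): the flat seed at depth `ℓ + 1` and the table law at
every co-size give the flat seed at depth `ℓ`.  Ramsey (`SubChar.ramsey_finite_colours`, colours `𝔽_p`) makes stratum `p − 1 − ℓ`
constant on a large window `B ⊆ X`; by the slice formula every slice of `f` over `B` is then `(ℓ+1)`-flat on `B` (the strata of `f`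
above `p − 1 − ℓ` are constant on all of `X`), so it has a `(p−1)`-block (depth `ℓ + 1`) and is exchangeable off `≤ K` in `B` (table
law); `exch_of_slices` transfers this to `f`: a block of co-size `≤ 2^p K` in `B`, of size `≥ p − 1` once `|B| ≥ 2^p K + p − 1`. -/
theorem flatSeed_step {K ℓ m₁ : ℕ} (hall : ∀ L : ℕ, TabLaw p K L) (h₁ : FlatSeedFrom p (ℓ + 1) m₁) :
    ∃ m₀ : ℕ, FlatSeedFrom p ℓ m₀ := by
  classical
  obtain ⟨N, hN⟩ := SubChar.ramsey_finite_colours (ZMod p) (p - 1 - ℓ) (max m₁ (2 ^ p * K + (p - 1)))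
  refine ⟨N, fun n f X hXN hdep hf hγ hflat => ?_⟩
  obtain ⟨γ, hγ0, htop⟩ := hγ
  obtain ⟨B, hBX, hbB, β, hβ⟩ := hN (Fin n) X hXN (fun T => chi p f T)
  have hslice : ∀ x : Fin n → Bool, ∃ Y : Finset (Fin n), Y ⊆ B ∧ B.card ≤ Y.card + K ∧
      Exch (fun u => f (SubLog.merge B u x)) Y := by
    intro x
    have hdep' := depOn_slice f B x
    have hf' : HasDegF p (fun u => f (SubLog.merge B u x)) (p - 1) := hasDegF_slice hf B x
    have htop' : TopConst p (fun u => f (SubLog.merge B u x)) B γ := topConst_slice hf htop (subset_refl B) hBX x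
    have hflat' : Flat p (fun u => f (SubLog.merge B u x)) B (ℓ + 1) := by
      intro k hk hkp T hT T' hT' hTc hT'c
      rw [chi_slice f B x hT, chi_slice f B x hT']
      refine Finset.sum_congr rfl fun U hU => ?_
      have hUW := Finset.mem_powerset.1 hU
      have hUB : ∀ m ∈ U, m ∉ B := fun m hm => (Finset.mem_sdiff.1 (Finset.mem_filter.1 (hUW hm)).1).2
      have hdisj : ∀ S ⊆ B, Disjoint S U := fun S hS =>
        Finset.disjoint_left.2 fun m hmS hmU => hUB m hmU (hS hmS)
      have hcTU : (T ∪ U).card = k + U.card := by rw [Finset.card_union_of_disjoint (hdisj T hT), hTc]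
      have hcT'U : (T' ∪ U).card = k + U.card := by rw [Finset.card_union_of_disjoint (hdisj T' hT'), hT'c]
      by_cases hUX : U ⊆ X
      · have h1 : T ∪ U ⊆ X := Finset.union_subset (hT.trans hBX) hUX
        have h2 : T' ∪ U ⊆ X := Finset.union_subset (hT'.trans hBX) hUX
        by_cases hdeg : k + U.card + 1 ≤ p
        · by_cases hU0 : U = ∅
          · subst hU0
            rw [Finset.union_empty, Finset.union_empty]
            by_cases hkk : k = p - 1 - ℓ
            · rw [hβ T hT (hTc.trans hkk), hβ T' hT' (hT'c.trans hkk)]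
            · exact hflat k (by omega) hkp T (hT.trans hBX) T' (hT'.trans hBX) hTc hT'c
          · have hUpos : 0 < U.card := Finset.card_pos.2 (Finset.nonempty_iff_ne_empty.2 hU0)
            exact hflat (k + U.card) (by omega) hdeg _ h1 _ h2 hcTU hcT'U
        · rw [chi_eq_zero_of_card hf (by rw [hcTU]; omega), chi_eq_zero_of_card hf (by rw [hcT'U]; omega)]
      · obtain ⟨m, hmU, hmX⟩ := Finset.not_subset.1 hUX
        rw [chi_eq_zero_of_not_subset hdep (fun hs => hmX (hs (Finset.mem_union_right T hmU))),
          chi_eq_zero_of_not_subset hdep (fun hs => hmX (hs (Finset.mem_union_right T' hmU)))]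
    obtain ⟨R, hRB, hRp, hexR⟩ := h₁ n _ B (le_trans (le_max_left _ _) hbB) hdep' hf' ⟨γ, hγ0, htop'⟩ hflat'
    exact hall B.card n _ B R hRB hRp (by omega) hdep' hf' ⟨γ, hγ0, htop'⟩ hexR
  obtain ⟨R, hRB, hRc, hexR⟩ := exch_of_slices hf B hslice
  refine ⟨R, hRB.trans hBX, ?_, hexR⟩
  have hb : 2 ^ p * K + (p - 1) ≤ B.card := le_trans (le_max_right _ _) hbB
  omega

/-- **THE WHOLE LADDER**: from the table law at every co-size, the flat seed at every depth `p − 1 − d`, `d = 0, 1, 2, …`. -/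
theorem flatSeed_all {K : ℕ} (hall : ∀ L : ℕ, TabLaw p K L) : ∀ d : ℕ, ∃ m₀ : ℕ, FlatSeedFrom p (p - 1 - d) m₀ := by
  intro d
  induction d with
  | zero => exact ⟨p - 1, flatSeed_base⟩
  | succ d ih =>
    obtain ⟨m₁, h₁⟩ := ih
    by_cases hd : d + 1 ≤ p - 1
    · have heq : p - 1 - d = (p - 1 - (d + 1)) + 1 := by omega
      rw [heq] at h₁
      exact flatSeed_step hall h₁
    · have heq : p - 1 - (d + 1) = p - 1 - d := by omega
      rw [heq]
      exact ⟨m₁, h₁⟩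

/-- Depth `1` is the plain seed: `FlatSeedFrom p 1 m₀` gives `SeedLevel p m` at every level `m ≥ m₀`. -/
theorem seedLevel_of_flatSeedFrom_one {m₀ m : ℕ} (h : FlatSeedFrom p 1 m₀) (hm : m₀ ≤ m) : SeedLevel p m := by
  intro n f X hXc hdep hf hγ
  obtain ⟨γ, hγ0, htop⟩ := hγ
  refine h n f X (by omega) hdep hf ⟨γ, hγ0, htop⟩ fun k hk hkp T hT T' hT' hTc hT'c => ?_
  have hk1 : k = p - 1 := by omega
  show SubLog.moeb (SubLog.indR (ZMod p) f) T = SubLog.moeb (SubLog.indR (ZMod p) f) T'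
  rw [htop T hT (hTc.trans hk1), htop T' hT' (hT'c.trans hk1)]

/-- **TABLE CORE ⟹ SEED AT EVERY LARGE LEVEL** (the g30 piece «Seed», in its strong all-levels form, from the g30 piece «Tab»). -/
theorem seed_from_of_tabAt (hT : TabAt p) : ∃ m₀ : ℕ, ∀ m : ℕ, m₀ ≤ m → SeedLevel p m := by
  obtain ⟨K, hall⟩ := (tabAt_iff_all p).1 hT
  obtain ⟨m₀, h⟩ := flatSeed_all hall (p - 2)
  have h1 : p - 1 - (p - 2) = 1 := by have := hp.out.two_le; omega
  rw [h1] at h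
  exact ⟨m₀, fun m hm => seedLevel_of_flatSeedFrom_one h hm⟩

/-- ★ `TabAt p → SeedAt p`. -/
theorem seedAt_of_tabAt (hT : TabAt p) : SeedAt p := by
  obtain ⟨m₀, h⟩ := seed_from_of_tabAt hT
  exact fun m₁ => ⟨max m₀ m₁, le_max_right _ _, h _ (le_max_left _ _)⟩

end Strata

end Summit.QuantumAdvantage.QuantumAdvantage.Theorems.StrataDial
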